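import Summits.QuantumFields.BalabanUV.T4Continuum.Support.NE7RepWGaugeOfRoutePi
import HarnessLib

/-!
# NE7CriticalPairLettersOfRoutePi — THE LETTERS OF THE CRITICAL-PAIR END FROM ROW NE3's ROUTE Π: F30's base letters with EXPLICIT witnesses, and the FAR
# ℓ¹-curl letter from (R3) of `rightInvW` AT THE FAR CONFIGURATION with the SAME weight and one far-end local quadratic letter

Cell `pub-balaban`, rung (B)+1 sub-cell t4, lineage `b2b-balaban-t4-ne7-p1` (CRUX PROVER NE7 #1 = OWNER of row NE7), generation 87; memo
`t4/b2b-balaban-t4-ne7-p1-g87/ROAD-B-IS-UNIQUENESS.md` §2.  File F234 (over F30 `NE7RepWGaugeOfRoutePi`, row NE3's `rightInvW` letters `NE3RightInverseLetters` and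
g25's `NE3LinearNormalPartPreSizes.preSizes_of_letters` ∕ `dirL1_coarse_le`); consumed by F235 `NE7CriticalPairOfRoutePi` (the END).

WHY.  F233 `NE7ConvOneStepWeightedCriticalUnique` (two TANGENT-CRITICAL configurations, one represented over the other, coincide modulo gauge — weighted currency)
asks at the BASE F26's letters (`X = X_T + X_N`, `X_T ∈ T_♮(U♯)`, `ν`, `κ₁`) FOR THE REPRESENTATIVE DIRECTION `X₀` ITSELF (F30 `repW_of_routePi` packages them
existentially, losing the identification with `hleaves`' `(u, X₀)`), and at the FAR end only the ℓ¹-curl letter of the far normal part.  THIS FILE supplies both from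
row NE3's route Π: §2 is F30 §4 un-packaged; §1 applies (R3) `sum_norm_curl_rightInvW_le` AT THE FAR CONFIGURATION `U♭` to `dirIter_{U♭} X₀`, whose coarse ℓ¹ size is
g25's `dirL1_coarse_le` from the SAME weight `m` and ONE far-end local quadratic letter `‖dirIter L (k+1) U♭ X₀ (z,κ)‖ ≤ C₂(M·m(z,κ))²` ((Π-REG-γ) TYPE at `U♭`).
WHAT ([folklore]; 0 def, 0 sorry).
§1 **`farLetter_of_routePi`** — at any `U♭ ∈ sfClass d L N ε (k+1)` (W6 regime): the far split `X₀ = X′_T + X′_N`, `X′_N := rightInvW_{U♭}(dirIter_{U♭} X₀)` skew,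
   `X′_T` skew periodic `U♭`-TANGENT, and `ε∕M²·Σ‖curl_{U♭} X′_N‖ ≤ ((curl1C∕(1−θℓ))·C₂·Ĉ²·ε)·‖X₀‖_{w,U}²` for EVERY background `U` of the weighted norm
   (`M⁻²dirSq ≤ ‖·‖_w²`): `κ′₁ = κ̂∕4`.
§2 **`baseLetters_of_routePi`** — F30 §4 with the witnesses EXPLICIT: for `hleaves`' `(u, X₀, α₀, m, C)` at `U♯ ∈ sfClass`: `u` unitary periodic, `X₀` periodic with
   `‖X₀‖ ≤ α₀`, `U′^u = U♯e^{X₀}`, `X₀ = X_T + X_N`, `X_T ∈ T_♮(U♯)`, `X_N := rightInvW_{U♯}(dirIter_{U♯} X₀)` skew, `‖X_N‖_w ≤ (ν̂∕(1−ν̂))‖X₀‖_w`,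
   `ε∕M²·Σ‖curl_{U♯} X_N‖ ≤ (κ̂∕(1−ν̂)²)‖X₀‖_w²`.
HONEST FRAMING (page 1): bookkeeping over row NE3's landed kernel theorems; the representation, the weight and the local quadratic letters are HYPOTHESES (row NE3's
binder), asserted for nothing; NOT (APE), NOT ONE-STEP, NOT NE7; spine 0∕9; finite T⁴ rung (B)+1 — NOT infinite volume, NOT mass gap, NOT `BetaPertH`, NOT Clay.
Continuum YM on T⁴ ⇐ BetaPertH ∧ nine spine estimates (0/9 proved); BetaPertH ⇐ (D1) ∧ (D4) ∧ CAP+tail; G-an2-4 gates asym, D1 and NE2/3/4.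
-/

set_option autoImplicit false

open scoped BigOperators Matrix Matrix.Norms.L2Operator
open NormedSpace Finset Set

namespace Summit.QuantumFields.BalabanUV.T4Continuum.NE7CriticalPairLettersOfRoutePi

open Literature.MathematicalPhysics.QuantumFieldTheory.Balaban1983to89
open B7Prop1Explicit B7Prop2Explicit
open T4AveragingDeficitWall (IsUnitaryCfg IsSkewDir SmallField vary curl curlSq dirSq dirL1)
open T4AveragingDeficitWallBoundary (IsPeriodicCfg periodBox)
open AveragingDeficitPeriodicCounting (IsPeriodicDir)
open AveragingDeficitMultiLevelPrep (LevelSmall tower TangentIter)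
open MinimalActionLevels (perWin)
open MinimalActionSandwich (admissible)
open MinimalActionRate (sfClass)
open NE3HessForm (dAction)
open NE3EnergyShapes (IsUnitarySite IsPeriodicSite)
open NE3EnergyWeightedShapes (energyNormW energyNormW_nonneg)
open NE3WeightedCoercivityTransfer (energyNormW_sq)
open NE3EnergyHessContTwoTerm (curlSq_nonneg dirSq_nonneg)
open NE3ProductPathBounds (energyNormW_sub_le)
open NE3TangentCovariantTower (dirIter tangentIter_iff_dirIter_eq_zero)
open NE3FrameFreeSliceW (frameFreeBlockLandauW)
open NE3SlicePoincareShape (SlicePoincare)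
open NE3ResidualSliceRep (dirIter_sub isPeriodicCfg_gaugeAct)
open NE3DecomposedRepOfLinearNormalPart (ResidualSliceRepT)
open NE3LinearNormalPartPreSizes (preSizes_of_letters dirL1_coarse_le)
open NE3EnergyRateWSupRoutePiRInv (dirIter_skew isPeriodicDir_dirIter)
open NE3DecomposedRepSfClass (levelRadius_rescale)
open NE3QbarIterCovLiftPrep (cruxC)
open NE3SmoothRightInverseW (rightInvW)
open NE3RightInverseSolveLetters (thetaLoc cruxC_nonneg cruxC_le_thetaLoc)
open NE3RightInverseL2Letter (l2C l2C_nonneg)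
open NE3RightInverseL1Letter (l1C l1C_nonneg)
open NE3HatInvCurlLetters (curl2C curl1C curl2C_nonneg curl1C_nonneg)
open NE3RightInverseLetters (rightInvW_exact rightInvW_skew rightInvW_periodic rightInvW_R1 curlSq_rightInvW_le sum_norm_curl_rightInvW_le rightInvW_R4)
open NE7RepWGaugeOfRoutePi (sub_mem_frameFreeBlockLandauW_symm line_of_kfree_line)

noncomputable section

variable {d : ℕ} {n : Type*} [Fintype n] [DecidableEq n]

/-! ## §1 The far letter: the ℓ¹-curl size of the far normal part from (R3) at the far configuration and the SAME weight -/

/-- **THE FAR SPLIT AND ITS ℓ¹-CURL LETTER FROM ROW NE3's ROUTE Π AT THE FAR CONFIGURATION.**  Level `k+1`, `M = L^{k+1}`, `U♭ ∈ sfClass d L N ε (k+1)`, W6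
regime (`thetaLoc d L·ε < 1`, `ε ≤ 1`, `LevelSmall d L k (ε∕M²)`); `X₀` skew `(N·M)`-periodic; a weight `m` with `M^d·Σ_{periodBox N} m² ≤ C²·dirSq X₀` and THE
FAR LOCAL QUADRATIC LETTER `‖dirIter L (k+1) U♭ X₀ (z,κ)‖ ≤ C₂(M·m(z,κ))²` on `periodBox N`; `C ≤ Ĉ`.  THEN `X₀ = X′_T + X′_N` with `X′_T` skew periodic
`U♭`-TANGENT, `X′_N` skew, and `ε∕M²·Σ_{perWin}‖curl_{U♭} X′_N‖ ≤ ((curl1C∕(1−thetaLoc·ε))·C₂·Ĉ²·ε)·‖X₀‖_{w,U}²` for every background `U` of the weighted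
norm. [folklore] -/
theorem farLetter_of_routePi [Nonempty n] {L N : ℕ} [NeZero L] [NeZero N] (hL : 2 ≤ L) (k : ℕ) {ε : ℝ} (hε : 0 < ε)
    (hls : LevelSmall d L k (ε / ((L : ℝ) ^ (k + 1)) ^ 2)) (hθl : thetaLoc d L * ε < 1) (hε1 : ε ≤ 1)
    {C₂ Ch : ℝ} (hC₂ : 0 ≤ C₂)
    {Ub : Site d → Fin d → (Matrix n n ℂ)ˣ} (hUb : Ub ∈ sfClass d L N ε (k + 1))
    {X₀ : Site d → Fin d → Matrix n n ℂ} (hXs : IsSkewDir X₀) (hXP : IsPeriodicDir X₀ ((N * L ^ (k + 1) : ℕ) : ℤ))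
    {m : Site d → Fin d → ℝ} {C : ℝ} (hC : 0 ≤ C)
    (hsq : ((L : ℝ) ^ (k + 1)) ^ d * ∑ z ∈ periodBox (d := d) N, ∑ κ : Fin d, m z κ ^ 2
      ≤ C ^ 2 * dirSq X₀ (periodBox (d := d) (N * L ^ (k + 1))))
    (hφq : ∀ z ∈ periodBox (d := d) N, ∀ κ : Fin d, ‖dirIter L (k + 1) Ub X₀ z κ‖ ≤ C₂ * ((L : ℝ) ^ (k + 1) * m z κ) ^ 2)
    (hCh : C ≤ Ch) (U : Site d → Fin d → (Matrix n n ℂ)ˣ) :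
    ∃ XT' XN' : Site d → Fin d → Matrix n n ℂ,
      X₀ = XT' + XN' ∧ IsSkewDir XT' ∧ IsPeriodicDir XT' ((N * L ^ (k + 1) : ℕ) : ℤ) ∧ TangentIter L k Ub XT' ∧ IsSkewDir XN' ∧
      ε / ((L : ℝ) ^ (k + 1)) ^ 2 * (∑ p ∈ perWin d (N * L ^ (k + 1)), ‖curl Ub XN' p‖)
        ≤ ((curl1C d L / (1 - thetaLoc d L * ε)) * C₂ * Ch ^ 2 * ε) * energyNormW L (k + 1) U X₀ (periodBox (d := d) (N * L ^ (k + 1))) ^ 2 := by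
  have hL1 : 1 ≤ L := by omega
  have hL1r : (1 : ℝ) ≤ L := by exact_mod_cast hL1
  -- the regime numerics
  have hθc : cruxC d L * ε < 1 := lt_of_le_of_lt (mul_le_mul_of_nonneg_right (cruxC_le_thetaLoc d L) hε.le) hθl
  have h1θl : 0 < 1 - thetaLoc d L * ε := by linarith
  -- the class data of the far configuration and the radius identities
  obtain ⟨hWu, hWP, hWx⟩ := hUb
  have hT : ((tower L N (k + 1) : ℕ) : ℤ) = ((N * L ^ (k + 1) : ℕ) : ℤ) := by
    rw [NE3FramePotBoundW.tower_eq_pow_mul, Nat.mul_comm]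
  have hWPt : IsPeriodicCfg Ub ((tower L N (k + 1) : ℕ) : ℤ) := by rw [hT]; exact hWP
  have hx : 0 ≤ ε / ((L : ℝ) ^ (k + 1)) ^ 2 := by positivity
  have hxM : ((L : ℝ) ^ (k + 1)) ^ 2 * (ε / ((L : ℝ) ^ (k + 1)) ^ 2) = ε := (levelRadius_rescale hL1 ε k).2
  set M : ℝ := (L : ℝ) ^ (k + 1) with hMdef
  have hM0 : 0 < M := by positivity
  have hM1 : 1 ≤ M := one_le_pow₀ hL1r
  have hθ : cruxC d L * (M ^ 2 * (ε / M ^ 2)) < 1 := by rw [hxM]; exact hθc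
  have hθlM : thetaLoc d L * (M ^ 2 * (ε / M ^ 2)) < 1 := by rw [hxM]; exact hθl
  have hεM : M ^ 2 * (ε / M ^ 2) ≤ 1 := by rw [hxM]; exact hε1
  -- the coarse datum at the far configuration: `φ′ := dirIter L (k+1) U♭ X₀`, skew and `N`-periodic
  have hφs : IsSkewDir (dirIter L (k + 1) Ub X₀) := dirIter_skew hL1 k hWu hx hls hWx hXs
  have hXPt : IsPeriodicDir X₀ ((tower L N (k + 1) : ℕ) : ℤ) := by rw [hT]; exact hXP
  have hφP : IsPeriodicDir (dirIter L (k + 1) Ub X₀) (N : ℤ) := isPeriodicDir_dirIter L N (k + 1) hWPt hXPt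
  -- the far normal part `X′_N := rightInvW_{U♭} φ′` and the far tangent part `X′_T := X₀ − X′_N`
  set Nn := rightInvW hL k hWu hx hls hWx N hθ hφs with hNn
  have hNs : IsSkewDir Nn := rightInvW_skew hL k hWu hx hls hWx hθ hφs
  have hNP : IsPeriodicDir Nn ((N * L ^ (k + 1) : ℕ) : ℤ) := rightInvW_periodic hL k hWu hWPt hx hls hWx hθ hφs
  have hexact : dirIter L (k + 1) Ub Nn = dirIter L (k + 1) Ub X₀ := rightInvW_exact hL k hWu hWPt hx hls hWx hθ hφs hφP
  refine ⟨fun y μ => X₀ y μ - Nn y μ, Nn, ?_, ?_, ?_, ?_, hNs, ?_⟩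
  · funext y μ; simp only [Pi.add_apply, sub_add_cancel]
  · intro y μ
    exact (skewAdjoint (Matrix n n ℂ)).sub_mem (hXs y μ) (hNs y μ)
  · intro y i μ
    show X₀ (y + ((N * L ^ (k + 1) : ℕ) : ℤ) • e i) μ - Nn (y + ((N * L ^ (k + 1) : ℕ) : ℤ) • e i) μ = X₀ y μ - Nn y μ
    rw [hXP y i μ, hNP y i μ]
  · rw [tangentIter_iff_dirIter_eq_zero, dirIter_sub hL1 k hWu hx hls hWx X₀ Nn, hexact]
    funext z κ
    simp only [sub_self, Pi.zero_apply]
  · -- (R3) at the far configuration, then g25's coarse ℓ¹ size from the weight and the far quadratic letter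
    have hR3 := sum_norm_curl_rightInvW_le hL k hWu hWPt hx hls hWx hθ hθlM hεM hφs
    rw [hxM] at hR3
    have hsq' : M ^ d * ∑ z ∈ periodBox (d := d) N, ∑ κ : Fin d, m z κ ^ 2 ≤ Ch ^ 2 * dirSq X₀ (periodBox (d := d) (N * L ^ (k + 1))) := by
      refine hsq.trans (mul_le_mul_of_nonneg_right (pow_le_pow_left₀ hC hCh 2) ?_)
      exact dirSq_nonneg _ _
    have hL1c := dirL1_coarse_le (N := N) (φ := dirIter L (k + 1) Ub X₀) hM0.le hC₂ hφq hsq'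
    -- `hL1c : M^d · dirL1 φ′ ≤ C₂·M²·(Ĉ²·dirSq X₀)`
    set c₃ : ℝ := curl1C d L / (1 - thetaLoc d L * ε) with hc₃
    have hc₃0 : 0 ≤ c₃ := by have := curl1C_nonneg d L; positivity
    set T : ℝ := dirSq X₀ (periodBox (d := d) (N * L ^ (k + 1))) with hTdef
    have hT0 : 0 ≤ T := dirSq_nonneg _ _
    have hMd : 0 < M ^ d := by positivity
    -- `Σ‖curl‖ ≤ c₃·(M^d∕M²)·dirL1 φ′ ≤ c₃·C₂·Ĉ²·T`
    have hstep : ∑ p ∈ perWin d (N * L ^ (k + 1)), ‖curl Ub Nn p‖ ≤ c₃ * C₂ * Ch ^ 2 * T := by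
      have h1 : dirL1 (dirIter L (k + 1) Ub X₀) (periodBox (d := d) N) ≤ C₂ * M ^ 2 * (Ch ^ 2 * T) / M ^ d := by
        rw [le_div_iff₀ hMd, mul_comm]; exact hL1c
      calc ∑ p ∈ perWin d (N * L ^ (k + 1)), ‖curl Ub Nn p‖
          ≤ c₃ * (M ^ d / M ^ 2) * dirL1 (dirIter L (k + 1) Ub X₀) (periodBox (d := d) N) := hR3
        _ ≤ c₃ * (M ^ d / M ^ 2) * (C₂ * M ^ 2 * (Ch ^ 2 * T) / M ^ d) := mul_le_mul_of_nonneg_left h1 (by positivity)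
        _ = c₃ * C₂ * Ch ^ 2 * T := by field_simp
    -- `M⁻²·dirSq X₀ ≤ ‖X₀‖_{w,U}²`
    have hE : (ε / M ^ 2) * T ≤ ε * energyNormW L (k + 1) U X₀ (periodBox (d := d) (N * L ^ (k + 1))) ^ 2 := by
      rw [energyNormW_sq]
      have hc : 0 ≤ curlSq U X₀ (periodBox (d := d) (N * L ^ (k + 1))) := curlSq_nonneg _ _ _
      have e1 : (ε / M ^ 2) * T = ε * ((M⁻¹) ^ 2 * T) := by field_simp
      rw [e1]
      exact mul_le_mul_of_nonneg_left (by linarith) hε.le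
    calc ε / M ^ 2 * ∑ p ∈ perWin d (N * L ^ (k + 1)), ‖curl Ub Nn p‖
        ≤ ε / M ^ 2 * (c₃ * C₂ * Ch ^ 2 * T) := mul_le_mul_of_nonneg_left hstep (by positivity)
      _ = (c₃ * C₂ * Ch ^ 2) * ((ε / M ^ 2) * T) := by ring
      _ ≤ (c₃ * C₂ * Ch ^ 2) * (ε * energyNormW L (k + 1) U X₀ (periodBox (d := d) (N * L ^ (k + 1))) ^ 2) :=
          mul_le_mul_of_nonneg_left hE (by positivity)
      _ = (c₃ * C₂ * Ch ^ 2 * ε) * energyNormW L (k + 1) U X₀ (periodBox (d := d) (N * L ^ (k + 1))) ^ 2 := by ring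

/-! ## §2 The base letters: F30 §4 with the witnesses explicit -/

set_option maxHeartbeats 400000 in
-- the `hrep` binder over all proof arguments of `rightInvW` elaborates slowly (as in F30); budget set explicitly
/-- **THE BASE LETTERS WITH EXPLICIT WITNESSES** (F30 `repW_of_routePi`, un-packaged): at level `k+1` with `U♯ ∈ sfClass d L N ε (k+1)`, the `hleaves` data
`(u, X₀, α₀, m, C)` of the pair `(U♯, U′)` and F31's ceilings give F26's letters FOR `X := X₀` ITSELF: `X₀ = X_T + X_N`, `X_T ∈ T_♮(U♯)`,
`X_N := rightInvW_{U♯}(dirIter_{U♯} X₀)` skew, `‖X_N‖_w ≤ (ν̂∕(1−ν̂))‖X₀‖_w`, `ε∕M²·Σ‖curl_{U♯} X_N‖ ≤ (κ̂∕(1−ν̂)²)‖X₀‖_w²`, plus the gauge data of `u` and the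
identity `U′^u = U♯e^{X₀}`. [folklore] -/
theorem baseLetters_of_routePi [Nonempty n] {L N : ℕ} [NeZero L] [NeZero N] (hL : 2 ≤ L) (k : ℕ) {ε : ℝ} (hε : 0 < ε)
    (hls : LevelSmall d L k (ε / ((L : ℝ) ^ (k + 1)) ^ 2)) (hθl : thetaLoc d L * ε < 1) (hε1 : ε ≤ 1)
    {C₂ αh Ch : ℝ} (hC₂ : 0 ≤ C₂) (hαh0 : 0 ≤ αh) (hαh1 : αh ≤ 1) (hCh0 : 0 ≤ Ch)
    {νh κh : ℝ} (hνh : νh = 2 * Real.sqrt (l2C d L / (1 - thetaLoc d L * ε) ^ 2 + curl2C d L / (1 - thetaLoc d L * ε) ^ 2) * C₂ * Ch * αh)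
    (hκh : κh = 4 * (curl1C d L / (1 - thetaLoc d L * ε)) * C₂ * Ch ^ 2 * ε) (hν : νh < 1)
    {Us U' : Site d → Fin d → (Matrix n n ℂ)ˣ} (hUs : Us ∈ sfClass d L N ε (k + 1))
    {u : Site d → (Matrix n n ℂ)ˣ} {X₀ : Site d → Fin d → Matrix n n ℂ} {α₀ : ℝ} {m : Site d → Fin d → ℝ} {C : ℝ}
    (hXs : IsSkewDir X₀)
    (hrep : ∀ (hWu : IsUnitaryCfg Us) (hx : 0 ≤ ε / ((L : ℝ) ^ (k + 1)) ^ 2) (hs : LevelSmall d L k (ε / ((L : ℝ) ^ (k + 1)) ^ 2))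
        (hWx : SmallField Us (ε / ((L : ℝ) ^ (k + 1)) ^ 2))
        (hθ : cruxC d L * (((L : ℝ) ^ (k + 1)) ^ 2 * (ε / ((L : ℝ) ^ (k + 1)) ^ 2)) < 1)
        (hφ : IsSkewDir (dirIter L (k + 1) Us X₀)),
      ResidualSliceRepT L N (k + 1) Us U' u X₀ (rightInvW hL k hWu hx hs hWx N hθ hφ) α₀)
    (hm0 : ∀ z κ, 0 ≤ m z κ) (hC : 0 ≤ C)
    (hsq : ((L : ℝ) ^ (k + 1)) ^ d * ∑ z ∈ periodBox (d := d) N, ∑ κ : Fin d, m z κ ^ 2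
      ≤ C ^ 2 * dirSq X₀ (periodBox (d := d) (N * L ^ (k + 1))))
    (hφq : ∀ z ∈ periodBox (d := d) N, ∀ κ : Fin d, ‖dirIter L (k + 1) Us X₀ z κ‖ ≤ C₂ * ((L : ℝ) ^ (k + 1) * m z κ) ^ 2)
    (hmh : ∀ z κ, m z κ * (L : ℝ) ^ (k + 1) ≤ αh) (hCh : C ≤ Ch) :
    ∃ XT XN : Site d → Fin d → Matrix n n ℂ,
      IsUnitarySite u ∧ IsPeriodicSite u ((N * L ^ (k + 1) : ℕ) : ℤ) ∧ IsPeriodicDir X₀ ((N * L ^ (k + 1) : ℕ) : ℤ) ∧ 0 ≤ α₀ ∧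
      (∀ x μ, ‖X₀ x μ‖ ≤ α₀) ∧ gaugeAct u U' = vary Us X₀ 1 ∧
      X₀ = XT + XN ∧ XT ∈ frameFreeBlockLandauW (d := d) (n := n) L N (k + 1) Us ∧ IsSkewDir XN ∧
      energyNormW L (k + 1) Us XN (periodBox (d := d) (N * L ^ (k + 1)))
        ≤ (νh / (1 - νh)) * energyNormW L (k + 1) Us X₀ (periodBox (d := d) (N * L ^ (k + 1))) ∧
      ε / ((L : ℝ) ^ (k + 1)) ^ 2 * (∑ p ∈ perWin d (N * L ^ (k + 1)), ‖curl Us XN p‖)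
        ≤ (κh / (1 - νh) ^ 2) * energyNormW L (k + 1) Us X₀ (periodBox (d := d) (N * L ^ (k + 1))) ^ 2 := by
  have hL1 : 1 ≤ L := by omega
  have hL1r : (1 : ℝ) ≤ L := by exact_mod_cast hL1
  -- the W6 regime numerics and the route-Π constants
  have hθc : cruxC d L * ε < 1 := lt_of_le_of_lt (mul_le_mul_of_nonneg_right (cruxC_le_thetaLoc d L) hε.le) hθl
  have h1θl : 0 < 1 - thetaLoc d L * ε := by linarith
  set c₁ : ℝ := l2C d L / (1 - thetaLoc d L * ε) ^ 2 with hc₁def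
  set c₂ : ℝ := curl2C d L / (1 - thetaLoc d L * ε) ^ 2 with hc₂def
  set c₃ : ℝ := curl1C d L / (1 - thetaLoc d L * ε) with hc₃def
  set c₄ : ℝ := l1C d L / (1 - thetaLoc d L * ε) with hc₄def
  have hc₁ : 0 ≤ c₁ := by have := l2C_nonneg d L; positivity
  have hc₂ : 0 ≤ c₂ := by have := curl2C_nonneg d L; positivity
  have hc₃ : 0 ≤ c₃ := by have := curl1C_nonneg d L; positivity
  have hc₄ : 0 ≤ c₄ := by have := l1C_nonneg d L; positivity
  -- the class data of the background `U♯` and the radius identities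
  obtain ⟨hWu, hWP, hWx⟩ := hUs
  have hT : ((tower L N (k + 1) : ℕ) : ℤ) = ((N * L ^ (k + 1) : ℕ) : ℤ) := by
    rw [NE3FramePotBoundW.tower_eq_pow_mul, Nat.mul_comm]
  have hWPt : IsPeriodicCfg Us ((tower L N (k + 1) : ℕ) : ℤ) := by rw [hT]; exact hWP
  have hx : 0 ≤ ε / ((L : ℝ) ^ (k + 1)) ^ 2 := by positivity
  have hxM : ((L : ℝ) ^ (k + 1)) ^ 2 * (ε / ((L : ℝ) ^ (k + 1)) ^ 2) = ε := (levelRadius_rescale hL1 ε k).2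
  set M : ℝ := (L : ℝ) ^ (k + 1) with hMdef
  have hM0 : 0 < M := by positivity
  have hM1 : 1 ≤ M := one_le_pow₀ hL1r
  have hθ : cruxC d L * (M ^ 2 * (ε / M ^ 2)) < 1 := by rw [hxM]; exact hθc
  have hθlM : thetaLoc d L * (M ^ 2 * (ε / M ^ 2)) < 1 := by rw [hxM]; exact hθl
  have hεM : M ^ 2 * (ε / M ^ 2) ≤ 1 := by rw [hxM]; exact hε1
  -- the coarse datum `φ := dirIter L (k+1) U♯ X₀`: skew, `N`-periodic
  have hφs : IsSkewDir (dirIter L (k + 1) Us X₀) := dirIter_skew hL1 k hWu hx hls hWx hXs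
  have h := hrep hWu hx hls hWx hθ hφs
  have hXP : IsPeriodicDir X₀ ((tower L N (k + 1) : ℕ) : ℤ) := by rw [hT]; exact h.per
  have hφP : IsPeriodicDir (dirIter L (k + 1) Us X₀) (N : ℤ) := isPeriodicDir_dirIter L N (k + 1) hWPt hXP
  -- the letters (R1)–(R4) of `Nn := rightInvW … φ`, radius identities rewritten to `ε`
  have hR1 := rightInvW_R1 hL k hWu hWPt hx hls hWx hθ hθlM hεM hφs
  have hR2 := curlSq_rightInvW_le hL k hWu hWPt hx hls hWx hθ hθlM hεM hφs
  have hR3 := sum_norm_curl_rightInvW_le hL k hWu hWPt hx hls hWx hθ hθlM hεM hφs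
  have hR4 := rightInvW_R4 hL k hWu hWPt hx hls hWx hθ hθlM hεM hφs
  rw [hxM] at hR1 hR2 hR3 hR4
  -- the pre-sizes (owner g25's counting) with the ceiling `α̂∕M` of the weight and the constant `Ĉ`
  have hsq' : M ^ d * ∑ z ∈ periodBox (d := d) N, ∑ κ : Fin d, m z κ ^ 2 ≤ Ch ^ 2 * dirSq X₀ (periodBox (d := d) (N * L ^ (k + 1))) := by
    refine hsq.trans (mul_le_mul_of_nonneg_right (pow_le_pow_left₀ hC hCh 2) ?_)
    exact dirSq_nonneg _ _
  have hmα : ∀ z κ, m z κ ≤ αh / M := fun z κ => by rw [le_div_iff₀ hM0]; exact hmh z κ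
  have hαM0 : 0 ≤ αh / M := by positivity
  have hν0 : 0 ≤ νh := by rw [hνh]; positivity
  have hρ : 2 * (c₁ + c₂) * C₂ ^ 2 * Ch ^ 2 * (αh / M * M) ^ 2 ≤ 1 / 2 := by
    have e : αh / M * M = αh := by field_simp
    rw [e]
    have hν2 : (νh) ^ 2 < 1 := by nlinarith
    have hsq2 : Real.sqrt (c₁ + c₂) ^ 2 = c₁ + c₂ := Real.sq_sqrt (add_nonneg hc₁ hc₂)
    have e2 : (νh) ^ 2 = 4 * (c₁ + c₂) * C₂ ^ 2 * Ch ^ 2 * αh ^ 2 := by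
      rw [show νh = 2 * Real.sqrt (c₁ + c₂) * C₂ * Ch * αh from hνh]
      rw [show (2 * Real.sqrt (c₁ + c₂) * C₂ * Ch * αh) ^ 2 = 4 * Real.sqrt (c₁ + c₂) ^ 2 * C₂ ^ 2 * Ch ^ 2 * αh ^ 2 by ring, hsq2]
    rw [e2] at hν2
    linarith
  have hJ1 : (αh / M + 0) * M ≤ 1 := by
    have e : (αh / M + 0) * M = αh := by rw [add_zero]; field_simp
    rw [e]; exact hαh1
  have ha : 0 ≤ ε / M ^ 2 := by positivity
  obtain ⟨hN1, hN2, -⟩ := preSizes_of_letters (N := N) hL1 (k + 1) Us (X₀ := X₀) (Nn := rightInvW hL k hWu hx hls hWx N hθ hφs)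
    (φ := dirIter L (k + 1) Us X₀) (m := m) (αN := 0) (a := ε / M ^ 2) hαM0 le_rfl hC₂ hCh0 hc₁ hc₂ hc₃ hc₄ ha hm0 hmα hsq' hφq
    hR1 hR2 hR3 hR4 hρ hJ1
  -- the two pre-sizes in the currency `ν̂`, `κ̂`
  have eν : 2 * Real.sqrt (c₁ + c₂) * C₂ * Ch * (αh / M * M) = νh := by
    have e : αh / M * M = αh := by field_simp
    rw [e, hνh]
  have ek : 4 * c₃ * C₂ * Ch ^ 2 * (ε / M ^ 2 * M ^ 2) = κh := by
    have e : ε / M ^ 2 * M ^ 2 = ε := by field_simp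
    rw [e, hκh]
  rw [eν] at hN1
  rw [ek] at hN2
  -- the conversion against `‖X₀‖_w` (F30 §2's algebra, witnesses kept); the normal part generalised to a variable first (cheap defeq)
  have hTm : (fun y μ => X₀ y μ - rightInvW hL k hWu hx hls hWx N hθ hφs y μ) ∈ frameFreeBlockLandauW (d := d) (n := n) L N (k + 1) Us :=
    sub_mem_frameFreeBlockLandauW_symm hL1 k hWu hx hls hWx h.tangent
  have hNsk : IsSkewDir (rightInvW hL k hWu hx hls hWx N hθ hφs) := rightInvW_skew hL k hWu hx hls hWx hθ hφs
  have hgauge := h.gauge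
  have hper := h.per
  have hα₀ := h.hα₀
  have hsup := h.sup
  have hrep' := h.rep
  clear h hrep hR1 hR2 hR3 hR4
  generalize rightInvW hL k hWu hx hls hWx N hθ hφs = Nn at hN1 hN2 hTm hNsk
  have h1ν : 0 < 1 - νh := by linarith
  have hk0 : 0 ≤ κh := by rw [hκh]; positivity
  have hEX0 := energyNormW_nonneg L (k + 1) Us X₀ (periodBox (d := d) (N * L ^ (k + 1)))
  have hEN0 := energyNormW_nonneg L (k + 1) Us Nn (periodBox (d := d) (N * L ^ (k + 1)))
  have hET0 := energyNormW_nonneg L (k + 1) Us (fun y μ => Nn y μ - X₀ y μ) (periodBox (d := d) (N * L ^ (k + 1)))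
  have hET1 : energyNormW L (k + 1) Us (fun y μ => Nn y μ - X₀ y μ) (periodBox (d := d) (N * L ^ (k + 1)))
      ≤ energyNormW L (k + 1) Us Nn (periodBox (d := d) (N * L ^ (k + 1))) + energyNormW L (k + 1) Us X₀ (periodBox (d := d) (N * L ^ (k + 1))) := by
    have e : (fun y μ => Nn y μ - X₀ y μ) = Nn - X₀ := by funext y μ; rfl
    rw [e]; exact energyNormW_sub_le L (k + 1) Us Nn X₀ _
  have hET3 : energyNormW L (k + 1) Us (fun y μ => Nn y μ - X₀ y μ) (periodBox (d := d) (N * L ^ (k + 1)))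
      ≤ energyNormW L (k + 1) Us X₀ (periodBox (d := d) (N * L ^ (k + 1))) / (1 - νh) := by
    rw [le_div_iff₀ h1ν]; nlinarith [hN1]
  have hνle : energyNormW L (k + 1) Us Nn (periodBox (d := d) (N * L ^ (k + 1)))
      ≤ νh / (1 - νh) * energyNormW L (k + 1) Us X₀ (periodBox (d := d) (N * L ^ (k + 1))) := by
    calc energyNormW L (k + 1) Us Nn (periodBox (d := d) (N * L ^ (k + 1)))
        ≤ νh * energyNormW L (k + 1) Us (fun y μ => Nn y μ - X₀ y μ) (periodBox (d := d) (N * L ^ (k + 1))) := hN1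
      _ ≤ νh * (energyNormW L (k + 1) Us X₀ (periodBox (d := d) (N * L ^ (k + 1))) / (1 - νh)) := mul_le_mul_of_nonneg_left hET3 hν0
      _ = νh / (1 - νh) * energyNormW L (k + 1) Us X₀ (periodBox (d := d) (N * L ^ (k + 1))) := by ring
  have hκle : ε / M ^ 2 * ∑ p ∈ perWin d (N * L ^ (k + 1)), ‖curl Us Nn p‖
      ≤ κh / (1 - νh) ^ 2 * energyNormW L (k + 1) Us X₀ (periodBox (d := d) (N * L ^ (k + 1))) ^ 2 := by
    have h2 : energyNormW L (k + 1) Us (fun y μ => Nn y μ - X₀ y μ) (periodBox (d := d) (N * L ^ (k + 1))) ^ 2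
        ≤ (energyNormW L (k + 1) Us X₀ (periodBox (d := d) (N * L ^ (k + 1))) / (1 - νh)) ^ 2 := pow_le_pow_left₀ hET0 hET3 2
    calc ε / M ^ 2 * ∑ p ∈ perWin d (N * L ^ (k + 1)), ‖curl Us Nn p‖
        ≤ κh * energyNormW L (k + 1) Us (fun y μ => Nn y μ - X₀ y μ) (periodBox (d := d) (N * L ^ (k + 1))) ^ 2 := hN2
      _ ≤ κh * (energyNormW L (k + 1) Us X₀ (periodBox (d := d) (N * L ^ (k + 1))) / (1 - νh)) ^ 2 := mul_le_mul_of_nonneg_left h2 hk0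
      _ = κh / (1 - νh) ^ 2 * energyNormW L (k + 1) Us X₀ (periodBox (d := d) (N * L ^ (k + 1))) ^ 2 := by field_simp
  refine ⟨fun y μ => X₀ y μ - Nn y μ, Nn, hgauge.1, hgauge.2, hper, hα₀, hsup, hrep', ?_, hTm, hNsk, hνle, hκle⟩
  funext y μ
  simp only [Pi.add_apply, sub_add_cancel]

end

end Summit.QuantumFields.BalabanUV.T4Continuum.NE7CriticalPairLettersOfRoutePi
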